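import Literature.NumberTheory.EllipticCurves.TwoDescentGaloisNormProofs
import HarnessLib

/-!
# The `2`-descent class of a CYCLIC `2`-power trace is the norm: iterating the involution step (Silverman AEC X.1, proofs only)

Sequel of `TwoDescentGaloisNormProofs` (the involution step: for `σ²P = P`, `(x(P) − e₁)(x(σP) − e₁)(x(P + σP) − e₁) = t²` with `σ t = t`).
Here the step is ITERATED along a cyclic group of order `2^a`: for a ring endomorphism `σ` of `F` fixing the Weierstrass coefficients and `e₁`, and a
point `z = (x₀, y₀)` with `σ^{2^a} z = z`, the trace `Tr z = Σ_{i<2^a} σ^i z` is computed by `a` successive involution steps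
`Q₀ = z`, `Q_{k+1} = Q_k + τ_k Q_k` with `τ_k = σ^{2^{a−k−1}}` (`τ_k²` fixes `Q_k`), `Q_a = Tr z`; and then (main theorem `cyclic_trace_sq_witness`)

  `(x(Tr z) − e₁) · ∏_{i<2^a} (σ^i x₀ − e₁) = T²` with `σ T = T`,

i.e. over the fixed field of `σ` the `2`-descent class of the trace is the class of the FULL NORM `∏_{i<2^a} (σ^i x₀ − e₁)` — the elementary form of
«cores ∘ κ = κ ∘ Tr» for a cyclic `2`-group (for `μ₂`-coefficients corestriction is the norm).  The partial traces are supplied by the caller as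
coordinate sequences `xs, ys : ℕ → F` satisfying the chord recursion (`addX`/`addY`/`slope` of Mathlib's group law), so the file stays definition-free;
the non-degeneracy hypotheses are `x(τ_k Q_k) ≠ x(Q_k)` (the step is a genuine chord) and `x(Q_k) ≠ e₁` (no partial trace meets `T₁`).
Together with the odd-order step (`twoDescentComponent_sum` + `Literature.FieldTheory.Kummer.sqClass_algebraMap_injective`) this covers every
finite abelian Galois group with CYCLIC `2`-part — e.g. `Gal(H_n/L_n) = 2Cl(ℚ(√−n))` for `n` with two prime factors (2-rank one), the case of the
genus period `Z(n) = Tr_{H_n/L_n} z_n` of Tian–Yuan–Zhang for `n = lq ≡ 7 (mod 8)`.  PROOFS ONLY: no `def`, no named fact.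

References: [cite: SilvermanAEC2009, Prop. X.1.4, Thm. X.1.1]; [cite: NeukirchSchmidtWingberg2008, Prop. 1.5.3, §1.5 (corestriction = norm on H¹ with trivial action)];
tree `TwoDescentGaloisNormProofs` (`exists_fixed_sq_witness`, `addX_fixed`, `addY_fixed`, `nonsingular_apply_of_fixed`).
-/

noncomputable section

namespace WeierstrassCurve.Affine

variable {F : Type*} [Field F] [DecidableEq F] {W : Affine F} {e₁ e₂ e₃ : F}

/-! ## §1 Plumbing: powers of a ring endomorphism, an even/odd product split -/

omit [DecidableEq F] in
/-- An element fixed by `σ` is fixed by every power `σ^m`. [cite: SilvermanAEC2009, Prop. X.1.4 (Galois bookkeeping)] -/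
theorem pow_apply_of_fixed (σ : F →+* F) {c : F} (hc : σ c = c) (m : ℕ) : (σ ^ m) c = c := by
  induction m with
  | zero => rfl
  | succ m ih => rw [pow_succ, RingHom.coe_mul, Function.comp_apply, hc, ih]

/-- `∏_{i<2m} f i = (∏_{i<m} f(2i)) · (∏_{i<m} f(2i+1))`. [cite: SilvermanAEC2009, Prop. X.1.4 (bookkeeping)] -/
theorem prod_range_two_mul {M : Type*} [CommMonoid M] (f : ℕ → M) (m : ℕ) :
    ∏ i ∈ Finset.range (2 * m), f i = (∏ i ∈ Finset.range m, f (2 * i)) * ∏ i ∈ Finset.range m, f (2 * i + 1) := by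
  induction m with
  | zero => simp
  | succ m ih =>
    rw [show 2 * (m + 1) = 2 * m + 1 + 1 by ring, Finset.prod_range_succ, Finset.prod_range_succ, ih,
      Finset.prod_range_succ, Finset.prod_range_succ]
    simp only [mul_assoc, mul_comm, mul_left_comm]

/-! ## §2 The cyclic `2`-power trace -/

/-- **THE `2`-DESCENT CLASS OF A CYCLIC `2`-POWER TRACE IS THE NORM.**  `E/F` elliptic with rational `2`-torsion `e₁, e₂, e₃`; `σ : F →+* F` fixing
`a₁, …, a₆` and `e₁`; coordinate sequences `xs, ys : ℕ → F` with `(xs 0, ys 0) = z ∈ E(F)`, `σ^{2^a} z = z`, and for `k < a` the chord recursion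
`Q_{k+1} = Q_k + τ_k Q_k`, `τ_k = σ^{2^{a−k−1}}` (in Mathlib's `addX`/`addY`/`slope`), with `x(τ_k Q_k) ≠ x(Q_k)` and `x(Q_k) ≠ e₁` for `k ≤ a`.  Then
**`(xs a − e₁) · ∏_{i<2^a} (σ^i (xs 0) − e₁) = T²` for some `T` with `σ T = T`** — and along the way every `Q_k` is a point of `E(F)` fixed
(coordinatewise) by `σ^{2^{a−k}}`.  [cite: SilvermanAEC2009, Prop. X.1.4, Thm. X.1.1] [cite: NeukirchSchmidtWingberg2008, §1.5] -/
theorem cyclic_trace_sq_witness [CharZero F] [W.IsElliptic] (h : W.SplitTwoTorsion e₁ e₂ e₃) (σ : F →+* F)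
    (ha₁ : σ W.a₁ = W.a₁) (ha₂ : σ W.a₂ = W.a₂) (ha₃ : σ W.a₃ = W.a₃) (ha₄ : σ W.a₄ = W.a₄) (ha₆ : σ W.a₆ = W.a₆) (he₁ : σ e₁ = e₁)
    (a : ℕ) (xs ys : ℕ → F) (h0 : W.Nonsingular (xs 0) (ys 0))
    (hper : (σ ^ 2 ^ a) (xs 0) = xs 0 ∧ (σ ^ 2 ^ a) (ys 0) = ys 0)
    (hstep : ∀ k < a,
      xs (k + 1) = W.addX (xs k) ((σ ^ 2 ^ (a - k - 1)) (xs k))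
        (W.slope (xs k) ((σ ^ 2 ^ (a - k - 1)) (xs k)) (ys k) ((σ ^ 2 ^ (a - k - 1)) (ys k))) ∧
      ys (k + 1) = W.addY (xs k) ((σ ^ 2 ^ (a - k - 1)) (xs k)) (ys k)
        (W.slope (xs k) ((σ ^ 2 ^ (a - k - 1)) (xs k)) (ys k) ((σ ^ 2 ^ (a - k - 1)) (ys k))))
    (hsep : ∀ k < a, (σ ^ 2 ^ (a - k - 1)) (xs k) ≠ xs k) (hne : ∀ k ≤ a, xs k ≠ e₁) :
    ∃ T : F, σ T = T ∧ (xs a - e₁) * ∏ i ∈ Finset.range (2 ^ a), ((σ ^ i) (xs 0) - e₁) = T ^ 2 := by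
  -- the invariant, by induction on `k ≤ a`
  have inv : ∀ k, k ≤ a →
      W.Nonsingular (xs k) (ys k) ∧
      ((σ ^ 2 ^ (a - k)) (xs k) = xs k ∧ (σ ^ 2 ^ (a - k)) (ys k) = ys k) ∧
      ∃ T : F, (σ ^ 2 ^ (a - k)) T = T ∧
        (xs k - e₁) * ∏ i ∈ Finset.range (2 ^ k), ((σ ^ (i * 2 ^ (a - k))) (xs 0) - e₁) = T ^ 2 := by
    intro k
    induction k with
    | zero =>
      intro _
      refine ⟨h0, by simpa using hper, xs 0 - e₁, ?_, ?_⟩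
      · rw [map_sub, Nat.sub_zero, hper.1, pow_apply_of_fixed σ he₁]
      · simp only [pow_zero, Finset.prod_range_one, zero_mul, RingHom.coe_one, id_eq, pow_two]
    | succ k ih =>
      intro hk
      have hk' : k < a := Nat.lt_of_succ_le hk
      obtain ⟨hQ, ⟨hfx, hfy⟩, T, hT, hprod⟩ := ih hk'.le
      obtain ⟨hX1, hY1⟩ := hstep k hk'
      have hsepk := hsep k hk'
      -- the exponent of this step
      set m : ℕ := a - k - 1 with hm'
      have hm : a - k = m + 1 := by omega
      have hak1 : a - (k + 1) = m := by omega
      rw [hm] at hfx hfy hT hprod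
      rw [hak1]
      -- the involution of this step
      set τ : F →+* F := σ ^ 2 ^ m with hτdef
      have hττ : τ * τ = σ ^ 2 ^ (m + 1) := by
        rw [hτdef, ← pow_add, ← two_mul, ← pow_succ']
      have mul_apply : ∀ (f g : F →+* F) (x : F), (f * g) x = f (g x) := fun f g x => rfl
      have hτa₁ : τ W.a₁ = W.a₁ := pow_apply_of_fixed σ ha₁ _
      have hτa₂ : τ W.a₂ = W.a₂ := pow_apply_of_fixed σ ha₂ _
      have hτa₃ : τ W.a₃ = W.a₃ := pow_apply_of_fixed σ ha₃ _
      have hτa₄ : τ W.a₄ = W.a₄ := pow_apply_of_fixed σ ha₄ _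
      have hτa₆ : τ W.a₆ = W.a₆ := pow_apply_of_fixed σ ha₆ _
      have hτe₁ : τ e₁ = e₁ := pow_apply_of_fixed σ he₁ _
      have hτx : τ (τ (xs k)) = xs k := by rw [← mul_apply, hττ, hfx]
      have hτy : τ (τ (ys k)) = ys k := by rw [← mul_apply, hττ, hfy]
      have hτT : τ (τ T) = T := by rw [← mul_apply, hττ, hT]
      -- (A) the new point is nonsingular, (B) it is `τ`-fixed
      have h₂ : W.Nonsingular (τ (xs k)) (τ (ys k)) := nonsingular_apply_of_fixed τ hτa₁ hτa₂ hτa₃ hτa₄ hτa₆ hQ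
      have hQ' : W.Nonsingular (xs (k + 1)) (ys (k + 1)) := by
        rw [hX1, hY1]
        exact nonsingular_add hQ h₂ fun hc => hsepk hc.1.symm
      have hfx' : τ (xs (k + 1)) = xs (k + 1) := by
        rw [hX1]; exact addX_fixed τ hτa₁ hτa₂ hτx hτy hsepk
      have hfy' : τ (ys (k + 1)) = ys (k + 1) := by
        rw [hY1]; exact addY_fixed τ hτa₁ hτa₂ hτa₃ hτx hτy hsepk
      refine ⟨hQ', ⟨hfx', hfy'⟩, ?_⟩
      -- (C) the witness
      obtain ⟨-, -, t, ht, hsq⟩ := exists_fixed_sq_witness τ h hτa₁ hτa₂ hτa₃ hτa₄ hτa₆ hτe₁ hQ hτx hτy hsepk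
      rw [← hX1] at hsq
      -- the product at level `k+1` splits into the level-`k` product and its `τ`-image
      have hsplit : ∏ i ∈ Finset.range (2 ^ (k + 1)), ((σ ^ (i * 2 ^ m)) (xs 0) - e₁) =
          (∏ i ∈ Finset.range (2 ^ k), ((σ ^ (i * 2 ^ (m + 1))) (xs 0) - e₁)) *
            τ (∏ i ∈ Finset.range (2 ^ k), ((σ ^ (i * 2 ^ (m + 1))) (xs 0) - e₁)) := by
        rw [pow_succ, mul_comm (2 ^ k) 2, prod_range_two_mul, map_prod]
        congr 1
        · refine Finset.prod_congr rfl fun i _ => ?_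
          rw [show 2 * i * 2 ^ m = i * 2 ^ (m + 1) by rw [pow_succ]; ring]
        · refine Finset.prod_congr rfl fun i _ => ?_
          rw [map_sub, hτe₁, ← mul_apply, hτdef, ← pow_add,
            show (2 * i + 1) * 2 ^ m = 2 ^ m + i * 2 ^ (m + 1) by rw [pow_succ]; ring]
      -- `τ` applied to the level-`k` identity
      have hprodτ : (τ (xs k) - e₁) * τ (∏ i ∈ Finset.range (2 ^ k), ((σ ^ (i * 2 ^ (m + 1))) (xs 0) - e₁)) = (τ T) ^ 2 := by
        have := congrArg τ hprod
        rwa [map_mul, map_sub, hτe₁, map_pow] at this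
      -- denominators
      have hxk : xs k - e₁ ≠ 0 := sub_ne_zero.mpr (hne k hk'.le)
      have hτxk : τ (xs k) - e₁ ≠ 0 := by
        intro h0
        apply hne k hk'.le
        rw [← hτx, sub_eq_zero.mp h0, hτe₁]
      set D : F := (xs k - e₁) * (τ (xs k) - e₁) with hD
      have hD0 : D ≠ 0 := mul_ne_zero hxk hτxk
      have hτD : τ D = D := by rw [hD, map_mul, map_sub, map_sub, hτe₁, hτx, mul_comm]
      refine ⟨t * (T * τ T) / D, ?_, ?_⟩
      · -- fixed by `σ^{2^m} = τ`
        rw [map_div₀, map_mul, map_mul, ht, hτT, hτD, mul_comm (τ T) T]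
      · -- the identity
        rw [hsplit]
        have key : (xs (k + 1) - e₁) * ((∏ i ∈ Finset.range (2 ^ k), ((σ ^ (i * 2 ^ (m + 1))) (xs 0) - e₁)) *
            τ (∏ i ∈ Finset.range (2 ^ k), ((σ ^ (i * 2 ^ (m + 1))) (xs 0) - e₁))) * D ^ 2 =
            (t * (T * τ T)) ^ 2 := by
          calc _ = ((xs k - e₁) * (τ (xs k) - e₁) * (xs (k + 1) - e₁)) *
                ((xs k - e₁) * ∏ i ∈ Finset.range (2 ^ k), ((σ ^ (i * 2 ^ (m + 1))) (xs 0) - e₁)) *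
                ((τ (xs k) - e₁) * τ (∏ i ∈ Finset.range (2 ^ k), ((σ ^ (i * 2 ^ (m + 1))) (xs 0) - e₁))) := by
                  rw [hD]; ring
            _ = t ^ 2 * T ^ 2 * (τ T) ^ 2 := by rw [hsq, hprod, hprodτ]
            _ = (t * (T * τ T)) ^ 2 := by ring
        rw [div_pow, eq_div_iff (pow_ne_zero 2 hD0), key]
  obtain ⟨-, -, T, hT, hprod⟩ := inv a le_rfl
  refine ⟨T, ?_, ?_⟩
  · simpa using hT
  · rw [← hprod]
    congr 1
    refine Finset.prod_congr rfl fun i _ => ?_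
    rw [Nat.sub_self, pow_zero, mul_one]

end WeierstrassCurve.Affine

end
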